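import Mathlib.RingTheory.Localization.AtPrime.Basic
import Literature.AlgebraicGeometry.Resolution.CobordantBlowupRegularCentre
import Summits.ResolutionOfSingularities.ResolutionOfSingularities.Theorems.WeightedInvariantWeightedConstructionFormalChartAlgebra
import Summits.ResolutionOfSingularities.ResolutionOfSingularities.Theorems.WeightedInvariantHypersurfaceCentreAlgebraize
import Summits.ResolutionOfSingularities.ResolutionOfSingularities.Theorems.WeightedInvariantIotaOrder
import HarnessLib

/-!
# The e.f.t. local weighted game (H2a′), point moves I: the exceptional chart `B/(t⁻¹) ≅ κ[X]` and the rank bound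

Topic: `Summits/ResolutionOfSingularities/ResolutionOfSingularities/Theorems`. Helper for the door item
`HypersurfaceCentreConstruction` (statement `stmt-ResolutionOfSingularities-19897`, route `WeightedInvariant`);
kernel K3a of the dim-2 design memo `L/res-type-098-w43/EFT-DIM2-DESIGN.md` (ORDER (o13) of `res-L1-w43-plan-1`),
for THE named rank `ι = iotaOrd` (res-type-073, p502169).

[OURS · L1 W4.3] Replaces the role of NO printed item; NOT a statement of the manuscript
[claim: Hironaka2017, status: under-review]. AI work, weaker than expert review.

## Content (§1 of the memo: «successor bookkeeping» for a POINT move, every dimension)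

`S` regular local, `u : Fin d → S` a regular system of parameters (`(u) = 𝔪`, `spanFinrank 𝔪 = d`), weights
`w` ALL POSITIVE, `B = S[t⁻¹, 𝒥ₙtⁿ]` (`extReesAlgebra (weightedMonomialIdeal u w)`), `uᵢ' = uᵢ t^{wᵢ} ∈ B`.

* `map_maximalIdeal_le_span_tInv` — `𝔪B ⊆ (t⁻¹)` (`uᵢ = t^{-wᵢ}·uᵢ'`);
* `vertexIdeal_le_span_range_uT` — `Vert ⊆ (u₁', …, u_d')`;
* `rho : B →+* MvPolynomial (Fin d) (S ⧸ (u))` — the EXCEPTIONAL CHART map `B → B/(t⁻¹) ≅ κ[X₁,…,X_d]`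
  (`uᵢ' ↦ Xᵢ`, `a ↦ ā`, `t⁻¹ ↦ 0`; surjective, kernel `(t⁻¹)`; from the tree's `extRees_exists_quotient_equiv`
  and the weighted quasi-regularity of a regular system of parameters);
* for a prime `𝔫 ∋ t⁻¹` of `B`: `nbar 𝔫 = rho(𝔫)` is prime, `rho⁻¹(nbar) = 𝔫`, OFF THE VERTEX `¬ (X) ⊆ nbar`
  (`not_span_X_le_nbar`), and **the rank bound** `iotaOrd B_𝔫 b ≤ iotaOrd κ[X]_{nbar} (rho b)`
  (`iotaOrd_le_iotaOrd_rho`: `𝔫ⁿ ↠ nbarⁿ`);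
* the SATURATED TRANSFORM of `f = Σ_{α∈Δ} a_α u^α + r` (`r ∈ 𝔪^N`, `m ≤ w·α` on `Δ`, `m < N`): `f = t^{-m}·G` with
  `G = Σ a_α t^{-(w·α−m)} u'^α + t^{-(N−m)} r'` (`algebraMap_eq_tInv_pow_mul_transform`), `rho G = Φ :=
  Σ_{w·α = m} ā_α X^α` (`rho_transform`), and if `Φ ≠ 0` then every factorisation `f = t⁻ᵃ g`, `t⁻¹ ∤ g`, has
  `a = m`, `g = G` (`transform_unique`) — so `iotaOrd B_𝔫 g ≤ iotaOrd κ[X]_{nbar} Φ` (`iotaOrd_transform_le`).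

## References

* J. Włodarczyk, *Functorial resolution by torus actions*, arXiv:2203.03090, Def. 2.3.5, §2.3.9 (the exceptional
  divisor of `B` is the weighted normal bundle `Spec (𝒪/(u))[u']`). [Wlodarczyk2022]
-/

noncomputable section

open IsLocalRing Literature.AlgebraicGeometry.Resolution
open LaurentPolynomial
open scoped LaurentPolynomial
open Summit.ResolutionOfSingularities.ResolutionOfSingularities.Cruxes.HypersurfaceCentreConstruction.LocalEngine
  (iotaOrd iotaOrd_le_of_ringHom)

set_option linter.dupNamespace false -- mandated namespace of this single-conjunct summit

namespace Summit.ResolutionOfSingularities.ResolutionOfSingularities.Theorems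

namespace LocalGameEFTPointMove

variable {S : Type} [CommRing S] {d : ℕ} (u : Fin d → S) (w : Fin d → ℕ)

/-! ## The rank bound along a quotient chart (generic) -/

/-- **Rank bound along a ring map**: for `ρ : B → P`, primes `𝔫' ⊂ P` and `𝔫 = ρ⁻¹(𝔫')`, and every `b ∈ B`,
`iotaOrd B_𝔫 b ≤ iotaOrd P_{𝔫'} (ρ b)` (the induced map `B_𝔫 → P_{𝔫'}` is local, so `𝔫ⁿ ↦ 𝔫'ⁿ`). Used with
`ρ = rho` (the exceptional chart) and `𝔫' = nbar 𝔫`. [folklore] -/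
theorem iotaOrd_localization_le_of_comap_eq {B P : Type} [CommRing B] [CommRing P] (ρ : B →+* P)
    (𝔫 : Ideal B) [𝔫.IsPrime] (𝔫' : Ideal P) [𝔫'.IsPrime] (h : 𝔫 = 𝔫'.comap ρ) (b : B) :
    iotaOrd (Localization.AtPrime 𝔫) (algebraMap B (Localization.AtPrime 𝔫) b) ≤
      iotaOrd (Localization.AtPrime 𝔫') (algebraMap P (Localization.AtPrime 𝔫') (ρ b)) := by
  set φ : Localization.AtPrime 𝔫 →+* Localization.AtPrime 𝔫' := Localization.localRingHom 𝔫 𝔫' ρ h with hφ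
  have hloc : IsLocalHom φ := Localization.isLocalHom_localRingHom 𝔫 𝔫' ρ h
  have hle : (maximalIdeal (Localization.AtPrime 𝔫)).map φ ≤ maximalIdeal (Localization.AtPrime 𝔫') :=
    @IsLocalRing.map_maximalIdeal_le _ _ _ _ _ _ φ hloc
  have h := iotaOrd_le_of_ringHom (Localization.AtPrime 𝔫) (Localization.AtPrime 𝔫') φ hle
    (algebraMap B (Localization.AtPrime 𝔫) b)
  rwa [hφ, Localization.localRingHom_to_map] at h

/-! ## The generators `uᵢ' = uᵢ t^{wᵢ}` -/

/-- The generator `uᵢ' = uᵢ t^{wᵢ}` of `B = S[t⁻¹, 𝒥ₙtⁿ]`. [cite: Wlodarczyk2022, §2.3.9] -/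
def uT (i : Fin d) : extReesAlgebra (weightedMonomialIdeal u w) :=
  ⟨C (u i) * T (w i : ℤ), extReesWeighted_C_mul_T_mem_extReesAlgebra u w i⟩

/-- `uᵢ'` as a Laurent polynomial. [folklore] -/
@[simp] theorem coe_uT (i : Fin d) :
    ((uT u w i : extReesAlgebra (weightedMonomialIdeal u w)) : S[T;T⁻¹]) = C (u i) * T (w i : ℤ) := rfl

/-- The local equations `uᵢ = (t⁻¹)^{wᵢ} · uᵢ'`. [cite: Wlodarczyk2022, §2.3.9] -/
theorem algebraMap_u_eq (i : Fin d) :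
    algebraMap S (extReesAlgebra (weightedMonomialIdeal u w)) (u i) =
      extReesAlgebra.tInv (weightedMonomialIdeal u w) ^ w i * uT u w i :=
  algebraMap_u_eq_tInv_pow_mul (stub_extReesAlgebra_weighted u w) (uT u w) (fun _ => rfl) i

/-- With all weights positive, `𝔪B ⊆ (t⁻¹)` when `(u) = 𝔪`. [folklore] -/
theorem map_maximalIdeal_le_span_tInv [IsLocalRing S] (hu : Ideal.span (Set.range u) = maximalIdeal S)
    (hw : ∀ i, 0 < w i) :
    (maximalIdeal S).map (algebraMap S (extReesAlgebra (weightedMonomialIdeal u w))) ≤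
      Ideal.span {extReesAlgebra.tInv (weightedMonomialIdeal u w)} := by
  rw [← hu, Ideal.map_span, Ideal.span_le]
  rintro _ ⟨_, ⟨i, rfl⟩, rfl⟩
  rw [SetLike.mem_coe, algebraMap_u_eq, ← Nat.sub_add_cancel (hw i), pow_succ, mul_assoc]
  exact Ideal.mul_mem_left _ _ (Ideal.mul_mem_right _ _ (Ideal.mem_span_singleton_self _))

/-- The vertex ideal lies in `(u₁', …, u_d')`. [cite: Wlodarczyk2022, Def. 2.3.5] -/
theorem vertexIdeal_le_span_range_uT :
    extReesAlgebra.vertexIdeal (weightedMonomialIdeal u w) ≤ Ideal.span (Set.range (uT u w)) :=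
  vertexIdeal_le_span_u' u w (stub_extReesAlgebra_weighted u w) (uT u w) (fun _ => rfl) (fun _ => rfl)

/-- Off the vertex some `uᵢ'` is missing from `𝔫`. [folklore] -/
theorem exists_uT_not_mem {𝔫 : Ideal (extReesAlgebra (weightedMonomialIdeal u w))}
    (hV : ¬ extReesAlgebra.vertexIdeal (weightedMonomialIdeal u w) ≤ 𝔫) : ∃ i, uT u w i ∉ 𝔫 := by
  by_contra h
  push Not at h
  exact hV ((vertexIdeal_le_span_range_uT u w).trans (Ideal.span_le.mpr (by rintro _ ⟨i, rfl⟩; exact h i)))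

/-! ## The exceptional chart `rho : B → κ[X]` -/

section Rho

variable [IsRegularLocalRing S] (hu : Ideal.span (Set.range u) = maximalIdeal S)
  (hd : (maximalIdeal S).spanFinrank = d) (hw : ∀ i, 0 < w i)

include hu hd hw

/-- A regular system of parameters with positive weights is weighted quasi-regular. [cite: Matsumura1987, Thm. 14.2] -/
theorem hwqr (n : ℕ) (P : MvPolynomial (Fin d) S) (hP : P.IsWeightedHomogeneous w n)
    (heval : MvPolynomial.eval u P ∈ (weightedFiltration u w).ideal (n + 1)) (β : Fin d →₀ ℕ) :
    P.coeff β ∈ Ideal.span (Set.range u) :=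
  weightedQuasiRegular_of_linearIndependent_toCotangent u w hw
    (fun i => hu ▸ Ideal.subset_span ⟨i, rfl⟩)
    (linearIndependent_toCotangent_of_span_eq_of_spanFinrank_eq u hu hd) n P hP heval β

/-- The exceptional fibre ring: `B/(t⁻¹) ≃ (S/(u))[X₁,…,X_d]`, `uᵢ' ↦ Xᵢ`, `a ↦ ā` (from the tree's
`extRees_exists_quotient_equiv`). [cite: Wlodarczyk2022, §2.3.9] -/
theorem exists_quotEquiv :
    ∃ e : (↥(extReesAlgebra (weightedMonomialIdeal u w)) ⧸
        Ideal.span {extReesAlgebra.tInv (weightedMonomialIdeal u w)}) ≃+*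
        MvPolynomial (Fin d) (S ⧸ Ideal.span (Set.range u)),
      (∀ i, e (Ideal.Quotient.mk _ (uT u w i)) = MvPolynomial.X i) ∧
      ∀ a : S, e (Ideal.Quotient.mk _ (algebraMap S _ a)) = MvPolynomial.C (Ideal.Quotient.mk _ a) :=
  extRees_exists_quotient_equiv (stub_extReesAlgebra_weighted u w) (uT u w) (fun _ => rfl) hw (hwqr u w hu hd hw)

/-- The exceptional fibre isomorphism (a choice). [cite: Wlodarczyk2022, §2.3.9] -/
def quotEquiv : (↥(extReesAlgebra (weightedMonomialIdeal u w)) ⧸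
    Ideal.span {extReesAlgebra.tInv (weightedMonomialIdeal u w)}) ≃+*
    MvPolynomial (Fin d) (S ⧸ Ideal.span (Set.range u)) :=
  (exists_quotEquiv u w hu hd hw).choose

/-- **The exceptional chart map** `rho : B → B/(t⁻¹) ≅ (S/(u))[X]`. [cite: Wlodarczyk2022, §2.3.9] -/
def rho : extReesAlgebra (weightedMonomialIdeal u w) →+* MvPolynomial (Fin d) (S ⧸ Ideal.span (Set.range u)) :=
  (quotEquiv u w hu hd hw).toRingHom.comp (Ideal.Quotient.mk _)

/-- `rho uᵢ' = Xᵢ`. [folklore] -/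
@[simp] theorem rho_uT (i : Fin d) : rho u w hu hd hw (uT u w i) = MvPolynomial.X i :=
  (exists_quotEquiv u w hu hd hw).choose_spec.1 i

/-- `rho a = ā`. [folklore] -/
@[simp] theorem rho_algebraMap (a : S) :
    rho u w hu hd hw (algebraMap S _ a) = MvPolynomial.C (Ideal.Quotient.mk _ a) :=
  (exists_quotEquiv u w hu hd hw).choose_spec.2 a

/-- `rho t⁻¹ = 0`. [folklore] -/
@[simp] theorem rho_tInv : rho u w hu hd hw (extReesAlgebra.tInv (weightedMonomialIdeal u w)) = 0 := by
  rw [rho, RingHom.comp_apply, Ideal.Quotient.eq_zero_iff_mem.mpr (Ideal.mem_span_singleton_self _), map_zero]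

/-- `rho` is surjective. [folklore] -/
theorem rho_surjective : Function.Surjective (rho u w hu hd hw) :=
  (quotEquiv u w hu hd hw).surjective.comp Ideal.Quotient.mk_surjective

/-- `ker rho = (t⁻¹)`. [folklore] -/
theorem ker_rho : RingHom.ker (rho u w hu hd hw) = Ideal.span {extReesAlgebra.tInv (weightedMonomialIdeal u w)} := by
  ext b
  rw [RingHom.mem_ker, rho, RingHom.comp_apply, RingEquiv.toRingHom_eq_coe, RingHom.coe_coe,
    EmbeddingLike.map_eq_zero_iff, Ideal.Quotient.eq_zero_iff_mem]

/-! ## Primes `𝔫 ∋ t⁻¹` and the rank bound -/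

variable (𝔫 : Ideal (extReesAlgebra (weightedMonomialIdeal u w)))
  (hT : extReesAlgebra.tInv (weightedMonomialIdeal u w) ∈ 𝔫)

/-- The image `nbar = rho(𝔫)` of an ideal of `B`. [folklore] -/
abbrev nbar : Ideal (MvPolynomial (Fin d) (S ⧸ Ideal.span (Set.range u))) := 𝔫.map (rho u w hu hd hw)

include hT

/-- `ker rho ⊆ 𝔫` when `t⁻¹ ∈ 𝔫`. [folklore] -/
theorem ker_rho_le : RingHom.ker (rho u w hu hd hw) ≤ 𝔫 := by
  rw [ker_rho, Ideal.span_singleton_le_iff_mem]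
  exact hT

/-- `rho⁻¹(nbar) = 𝔫`. [folklore] -/
theorem comap_rho_nbar : (nbar u w hu hd hw 𝔫).comap (rho u w hu hd hw) = 𝔫 := by
  show Ideal.comap _ (Ideal.map _ 𝔫) = 𝔫
  rw [Ideal.comap_map_of_surjective' _ (rho_surjective u w hu hd hw)]
  exact sup_eq_left.mpr (ker_rho_le u w hu hd hw 𝔫 hT)

/-- OFF THE VERTEX the image ideal misses some variable: `¬ (X₁,…,X_d) ⊆ nbar`. [folklore] -/
theorem not_span_X_le_nbar (hV : ¬ extReesAlgebra.vertexIdeal (weightedMonomialIdeal u w) ≤ 𝔫) :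
    ¬ Ideal.span (Set.range (MvPolynomial.X : Fin d → MvPolynomial (Fin d) (S ⧸ Ideal.span (Set.range u)))) ≤
      nbar u w hu hd hw 𝔫 := by
  intro hle
  obtain ⟨i, hi⟩ := exists_uT_not_mem u w hV
  apply hi
  rw [← comap_rho_nbar u w hu hd hw 𝔫 hT, Ideal.mem_comap, rho_uT]
  exact hle (Ideal.subset_span ⟨i, rfl⟩)

variable [𝔫.IsPrime]

/-- `nbar` is prime. [folklore] -/
theorem nbar_isPrime : (nbar u w hu hd hw 𝔫).IsPrime :=
  Ideal.map_isPrime_of_surjective (rho_surjective u w hu hd hw) (ker_rho_le u w hu hd hw 𝔫 hT)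

end Rho

/-! ## Cancelling powers of a non-divisor (uniqueness of the saturated transform) -/

/-- In a domain: `xᵃ g = xᵐ G` with `x ∤ g`, `x ∤ G` forces `a = m` and `g = G`. [folklore] -/
theorem pow_mul_cancel_of_not_dvd {R : Type*} [CommRing R] [IsDomain R] {x : R} (hx : x ≠ 0) {a m : ℕ} {g G : R}
    (h : x ^ a * g = x ^ m * G) (hg : ¬ x ∣ g) (hG : ¬ x ∣ G) : a = m ∧ g = G := by
  rcases lt_trichotomy a m with hlt | rfl | hgt
  · exfalso
    apply hg
    refine ⟨x ^ (m - a - 1) * G, mul_left_cancel₀ (pow_ne_zero a hx) ?_⟩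
    rw [h, ← mul_assoc, ← mul_assoc, ← pow_succ, ← pow_add]
    congr 2
    omega
  · exact ⟨rfl, mul_left_cancel₀ (pow_ne_zero a hx) h⟩
  · exfalso
    apply hG
    refine ⟨x ^ (a - m - 1) * g, mul_left_cancel₀ (pow_ne_zero m hx) ?_⟩
    rw [← h, ← mul_assoc, ← mul_assoc, ← pow_succ, ← pow_add]
    congr 2
    omega

/-! ## The saturated transform of a position written on monomials of the move -/

section Transform

variable [IsRegularLocalRing S] (hu : Ideal.span (Set.range u) = maximalIdeal S)
  (hd : (maximalIdeal S).spanFinrank = d) (hw : ∀ i, 0 < w i)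

/-- The remainder lift: for `r ∈ 𝔪^N` (`N ≥ 1`, all weights positive, `(u) = 𝔪`) the element `r t^N ∈ B`. [folklore] -/
def rT {N : ℕ} (hN : 0 < N) {r : S} (hr : r ∈ (maximalIdeal S) ^ N) : extReesAlgebra (weightedMonomialIdeal u w) :=
  ⟨C r * T (N : ℤ), extReesAlgebra.C_mul_T_mem _ hN (pow_le_weightedMonomialIdeal_of_span_eq u w hw hu N hr)⟩

include hw hu in
/-- `r = (t⁻¹)^N · (r t^N)`. [folklore] -/
theorem algebraMap_eq_tInv_pow_mul_rT {N : ℕ} (hN : 0 < N) {r : S} (hr : r ∈ (maximalIdeal S) ^ N) :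
    algebraMap S (extReesAlgebra (weightedMonomialIdeal u w)) r =
      extReesAlgebra.tInv (weightedMonomialIdeal u w) ^ N * rT u w hu hw hN hr := by
  apply Subtype.ext
  rw [Subalgebra.coe_algebraMap, ← C_eq_algebraMap, MulMemClass.coe_mul, SubmonoidClass.coe_pow,
    extReesAlgebra.coe_tInv, T_pow, rT, mul_left_comm, ← T_add]
  simp

/-- The saturated-transform candidate of `f = Σ_{α∈Δ} a_α u^α + r`:
`G = Σ_{α∈Δ} a_α (t⁻¹)^{w·α−m} u'^α + (t⁻¹)^{N−m} (r t^N)`. [folklore] -/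
def transform (Δ : Finset (Fin d → ℕ)) (a : (Fin d → ℕ) → S) (m : ℕ) {N : ℕ} (hN : 0 < N) {r : S}
    (hr : r ∈ (maximalIdeal S) ^ N) : extReesAlgebra (weightedMonomialIdeal u w) :=
  ∑ α ∈ Δ, algebraMap S _ (a α) * extReesAlgebra.tInv (weightedMonomialIdeal u w) ^ (∑ i, w i * α i - m) *
      ∏ i, uT u w i ^ α i +
    extReesAlgebra.tInv (weightedMonomialIdeal u w) ^ (N - m) * rT u w hu hw hN hr

include hu hw in
/-- **`f = (t⁻¹)ᵐ · G`** for `f = Σ_{α∈Δ} a_α u^α + r`, `m ≤ w·α` on `Δ`, `m ≤ N`. [cite: Wlodarczyk2022, §3.3] -/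
theorem algebraMap_eq_tInv_pow_mul_transform (Δ : Finset (Fin d → ℕ)) (a : (Fin d → ℕ) → S) (m : ℕ) {N : ℕ}
    (hN : 0 < N) {r : S} (hr : r ∈ (maximalIdeal S) ^ N) (hm : ∀ α ∈ Δ, m ≤ ∑ i, w i * α i) (hmN : m ≤ N)
    {f : S} (hf : f = ∑ α ∈ Δ, a α * ∏ i, u i ^ α i + r) :
    algebraMap S (extReesAlgebra (weightedMonomialIdeal u w)) f =
      extReesAlgebra.tInv (weightedMonomialIdeal u w) ^ m * transform u w hu hw Δ a m hN hr := by
  rw [hf, map_add, map_sum, transform, mul_add, Finset.mul_sum, ← mul_assoc, ← pow_add, Nat.add_sub_cancel' hmN,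
    ← algebraMap_eq_tInv_pow_mul_rT u w hu hw hN hr]
  congr 1
  refine Finset.sum_congr rfl fun α hα => ?_
  rw [map_mul, map_prod]
  simp_rw [map_pow, algebraMap_u_eq u w, mul_pow, Finset.prod_mul_distrib, ← pow_mul, Finset.prod_pow_eq_pow_sum]
  rw [show (∑ i, w i * α i) = m + (∑ i, w i * α i - m) from (Nat.add_sub_cancel' (hm α hα)).symm, pow_add,
    Nat.add_sub_cancel_left]
  ring

include hu hd hw in
/-- **The image of `G` in the exceptional chart is the face polynomial**
`Φ = Σ_{α∈Δ, w·α = m} ā_α X^α` (for `m < N`). [cite: Wlodarczyk2022, Lemma 4.1.7] -/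
theorem rho_transform (Δ : Finset (Fin d → ℕ)) (a : (Fin d → ℕ) → S) (m : ℕ) {N : ℕ} (hN : 0 < N) {r : S}
    (hr : r ∈ (maximalIdeal S) ^ N) (hm : ∀ α ∈ Δ, m ≤ ∑ i, w i * α i) (hmN : m < N) :
    rho u w hu hd hw (transform u w hu hw Δ a m hN hr) =
      ∑ α ∈ Δ.filter (fun α => ∑ i, w i * α i = m),
        MvPolynomial.C (Ideal.Quotient.mk _ (a α)) * ∏ i, MvPolynomial.X i ^ α i := by
  classical
  rw [transform, map_add, map_sum, map_mul, map_pow, rho_tInv, zero_pow (by omega), zero_mul, add_zero,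
    Finset.sum_filter]
  refine Finset.sum_congr rfl fun α hα => ?_
  rw [map_mul, map_mul, map_pow, map_prod, rho_tInv, rho_algebraMap]
  simp_rw [map_pow, rho_uT]
  split_ifs with h
  · rw [h, Nat.sub_self, pow_zero, mul_one]
  · have hlt : m < ∑ i, w i * α i := lt_of_le_of_ne (hm α hα) (Ne.symm h)
    rw [zero_pow (by omega), mul_zero, zero_mul]

include hu hd hw in
/-- **Uniqueness of the saturated transform.** If the face polynomial `rho G` is non-zero then `t⁻¹ ∤ G`, and every
factorisation `f = (t⁻¹)ᵃ g` with `t⁻¹ ∤ g` has `a = m` and `g = G`. [cite: Wlodarczyk2022, §3.3] -/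
theorem transform_unique (Δ : Finset (Fin d → ℕ)) (a : (Fin d → ℕ) → S) (m : ℕ) {N : ℕ} (hN : 0 < N) {r : S}
    (hr : r ∈ (maximalIdeal S) ^ N) (hm : ∀ α ∈ Δ, m ≤ ∑ i, w i * α i) (hmN : m < N)
    {f : S} (hf : f = ∑ α ∈ Δ, a α * ∏ i, u i ^ α i + r)
    (hΦ : rho u w hu hd hw (transform u w hu hw Δ a m hN hr) ≠ 0)
    {a' : ℕ} {g : extReesAlgebra (weightedMonomialIdeal u w)}
    (hfg : algebraMap S (extReesAlgebra (weightedMonomialIdeal u w)) f =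
      extReesAlgebra.tInv (weightedMonomialIdeal u w) ^ a' * g)
    (hndvd : ¬ extReesAlgebra.tInv (weightedMonomialIdeal u w) ∣ g) :
    a' = m ∧ g = transform u w hu hw Δ a m hN hr := by
  haveI := isDomain_of_isRegularLocalRing S
  have hG : ¬ extReesAlgebra.tInv (weightedMonomialIdeal u w) ∣ transform u w hu hw Δ a m hN hr := by
    rintro ⟨c, hc⟩
    apply hΦ
    rw [hc, map_mul, rho_tInv, zero_mul]
  have h0 : extReesAlgebra.tInv (weightedMonomialIdeal u w) ≠ 0 := by
    intro h
    have h' := congrArg Subtype.val h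
    rw [extReesAlgebra.coe_tInv, ZeroMemClass.coe_zero] at h'
    exact (isUnit_T (R := S) (-1 : ℤ)).ne_zero h'
  rw [algebraMap_eq_tInv_pow_mul_transform u w hu hw Δ a m hN hr hm hmN.le hf] at hfg
  exact pow_mul_cancel_of_not_dvd h0 hfg.symm hndvd hG

end Transform


end LocalGameEFTPointMove

end Summit.ResolutionOfSingularities.ResolutionOfSingularities.Theorems

end
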